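import Literature.Computability.AlgebraicComplexity.NewtonPolygonTauRefinedTransfer
import Literature.Computability.AlgebraicComplexity.NewtonPolygonTauProofs
import Literature.Computability.AlgebraicComplexity.ValiantConjectureProofs
import Summits.ValiantsHypothesis.ValiantsHypothesis.Theses.NewtonUnitEquations
import Summits.ValiantsHypothesis.ValiantsHypothesis.Theorems.HubHub
import HarnessLib

/-!
# Open-question harvest, typed — val-idea-37 g9 (crux `TwoProducts`, stmt-ValiantsHypothesis-5906)

THE HARVESTED QUESTION (print). P. Hrubeš, A. Yehudayoff, *Shadows of Newton polytopes*, CCC 2021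
(LIPIcs 200:9; journal version Israel J. Math. 256 (2023), doi:10.1007/s11856-023-2510-z), §9
"Open problems", Problem 2, second clause: «Is Conjecture 47 [= the weak Newton-polygon
τ-conjecture `#vert Newt(Σ_{i<k} Π_{j<m} f_ij) ≤ 2^{O(m)} (kt)^{O(1)}`, the tree's
`KPTT.newtonTauWeak`] true? If not, is it true when `f` in (7) is required to have CONVEXLY
INDEPENDENT SUPPORT?» — i.e. when every monomial of the OUTPUT `f = Σ Π f_ij` is a vertex of its
Newton polygon. The board cites «HrubesYehudayoff2021 Open Problem 2» only as a SOURCE of the crux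
`TwoProducts` (its first clause; route files NewtonFrames / NewtonUnitEquations); the second clause —
the convexly-independent-OUTPUT restriction — is typed nowhere on the 5906 board (KB-g3,
KEEPKILL-final, LADDER §7b, the Cruxes/TwoProducts workfiles) or in the tree, whose convexly
independent material (`NewtonPolygonKPTTProp1*`, `…SlopeLadderBlocking`, `…BlockConvexShadow`) is
about convexly independent SUBSETS of Minkowski sums (KPTT Prop. 1 geometry), and which records
KPTT's Theorem 1 (`KPTT.theorem1`, `theorem1_holds`) with the UNRESTRICTED hypothesis only.

WHAT THIS FILE TYPES AND PROVES (0 sorry; imports = landed Literature + the route file + the hub).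

§1 `NewtonTauWeakCI` — the weak conjecture (`2^{am}(kt+2)^b`, KPTT's «for instance» form) restricted
   to convexly independent OUTPUT support, in the count form `newtonVertexCount F = F.support.card`
   (⇔ every support point is a vertex, `ci_iff`, because the vertices of `conv S` always lie in `S`);
   `NewtonTauConjectureCI` — the same restriction of HY's Conjecture 47 AS PRINTED (= KPTT Conjecture 1,
   polynomial form `(kmt+2)^C`); implications `newtonTauWeak → NewtonTauWeakCI`,
   `newtonTauConjecture → NewtonTauConjectureCI → NewtonTauWeakCI` (all trivial / tree arithmetic);
   and the SPARSITY READING `NewtonTauWeakCI ↔ SparseSumsCI`: under convex independence vertices =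
   monomials, so the harvested question is «cancelling sums of products of sparse polynomials whose
   support is in convex position are themselves `2^{O(m)}(kt)^{O(1)}`-sparse» (fewnomial currency).
§2 KERNEL TRANSFER `not_isVPFamily_per_of_newtonTauWeakCI : NewtonTauWeakCI → per ∉ VP_ℂ`,
   `valiantsHypothesis_of_newtonTauWeakCI : NewtonTauWeakCI → ValiantsHypothesis` and
   `valiantsHypothesis_of_newtonTauConjectureCI` (the printed question, answered yes, gives VP≠VNP).  Observation
   behind it: KPTT's transfer (§3 of the paper; the tree's `theorem1_holds`) consumes the
   Newton-polygon hypothesis at exactly ONE polynomial per `n`, the witness `F_n = kpttPoly n`, whose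
   `2ⁿ` support points lie on a strictly concave parabola and are ALL vertices
   (`newtonVertexCount_kpttPoly`, `card_support_kpttPoly`) — so the convexly-independent-support
   restriction costs the transfer nothing: HY's weaker open problem is still summit-sufficient.
   The proof is `theorem1_holds` verbatim with the extra hypothesis discharged at `F_n`.
§3 `TwoProductsCI` — the `k = 2` rung of §1 in the currency of the crux (`∏ f − ∏ g`, t-sparse
   factors, convexly independent output): `TwoProducts → TwoProductsCI` (restriction) and
   `NewtonTauWeakCI → TwoProductsCI` (k = 2, one factor negated; constants `(a + b, b)`).
§4 CALIBRATION identity (`ring`): `(P + q)(P − q) − (P + s + q)(P + s − q) = −(2·s·P + s·s)` — the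
   `m = 2` family showing that convexly independent outputs DO carry many hidden vertices: with
   `supp P` = `t` points on a parabola, `s = 1`, `q` one far monomial, the output `−(2P + 1)` has
   `t + 1` support points, all vertices, `t` of them strictly inside `conv(supp(f₁f₂) ∪ supp(g₁g₂))`
   (exact check t = 4, 6, 10, 20 in the memo) — so the CI slice is not disposed of by the
   «no internal cancellation ⇒ ≤ Σ|supp|» remark, and neg-1's m = 3 exceptional corner TRIPLE-34
   (tailDiff `−2X^(8,8)+2X^(9,5)+4X^(10,6)`, three hidden vertices in convex position) lies in it too.

HONEST FRAME: §2 is a re-targeting of a LANDED transfer, not progress on the count; `NewtonTauWeakCI`,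
`TwoProductsCI`, `TwoProducts`, `PlanarCellBound`, `ResidualLawV25` are OPEN and UNMOVED; no bound on
hidden vertices is proved here; VP ≠ VNP is NOT proved.  No instances, no notation, no new axioms.
[cite: HrubesYehudayoff2021, §9 Problem 2; Conjecture 47] [cite: KoiranPortierTavenasThomasse2015, Thm. 1, §3]
-/

noncomputable section

set_option linter.dupNamespace false

open scoped BigOperators Classical
open MvPolynomial
open Literature.Computability.AlgebraicComplexity
open Literature.Computability.AlgebraicComplexity.KPTT
open Literature.Computability.AlgebraicComplexity.TavenasVn

namespace Summit.ValiantsHypothesis.ValiantsHypothesis.Cruxes.TwoProducts.HarvestCI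

/-! ## §1 Hrubeš–Yehudayoff Open Problem 2(b), typed -/

/-- **HY21 §9 Problem 2, second clause, typed (count form).** The weak Newton-polygon τ-conjecture
(`KPTT.newtonTauWeak`, = HY Conjecture 47) restricted to outputs `F = Σ_{i<k} Π_{j<m} f_ij` with
CONVEXLY INDEPENDENT SUPPORT: every monomial of `F` is a vertex of `Newt(F)`, stated as
`newtonVertexCount F = #supp F`. OPEN (posed by Hrubeš–Yehudayoff as the fallback question should
Conjecture 47 fail); a `Prop`, never asserted. [cite: HrubesYehudayoff2021, §9 Problem 2] -/
def NewtonTauWeakCI : Prop :=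
  ∃ a b : ℕ, ∀ (k m t : ℕ) (f : Fin k → Fin m → MvPolynomial (Fin 2) ℂ),
    (∀ i j, (f i j).support.card ≤ t) →
      newtonVertexCount (∑ i, ∏ j, f i j) = (∑ i, ∏ j, f i j).support.card →
        newtonVertexCount (∑ i, ∏ j, f i j) ≤ 2 ^ (a * m) * (k * t + 2) ^ b

/-- The restriction is weaker than the weak conjecture itself. [folklore] -/
theorem newtonTauWeakCI_of_newtonTauWeak : newtonTauWeak → NewtonTauWeakCI := by
  rintro ⟨a, b, hab⟩
  exact ⟨a, b, fun k m t f hf _ => hab k m t f hf⟩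

/-- **HY21 §9 Problem 2(b) in Hrubeš–Yehudayoff's own (polynomial) currency**: their Conjecture 47
is KPTT's Conjecture 1 «at most `O((pqr)^c)` vertices» (the tree's `KPTT.newtonTauConjecture`,
recorded as `(kmt+2)^C`), here restricted to convexly independent output support. OPEN; a `Prop`.
[cite: HrubesYehudayoff2021, Conjecture 47; §9 Problem 2] [cite: KoiranPortierTavenasThomasse2015, Conjecture 1] -/
def NewtonTauConjectureCI : Prop :=
  ∃ C : ℕ, ∀ (k m t : ℕ) (f : Fin k → Fin m → MvPolynomial (Fin 2) ℂ),
    (∀ i j, (f i j).support.card ≤ t) →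
      newtonVertexCount (∑ i, ∏ j, f i j) = (∑ i, ∏ j, f i j).support.card →
        newtonVertexCount (∑ i, ∏ j, f i j) ≤ (k * m * t + 2) ^ C

/-- Restriction of Conjecture 1 / 47. [folklore] -/
theorem newtonTauConjectureCI_of_newtonTauConjecture : newtonTauConjecture → NewtonTauConjectureCI := by
  rintro ⟨C, hC⟩
  exact ⟨C, fun k m t f hf _ => hC k m t f hf⟩

/-- Polynomial form ⇒ weak form under the restriction (`(kmt+2)^C ≤ 2^{Cm}(kt+2)^C`, the tree's
`pow_kmt_le_two_pow_mul_pow`, as in `newtonTauWeak_of_newtonTauConjecture`). [folklore] -/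
theorem newtonTauWeakCI_of_newtonTauConjectureCI : NewtonTauConjectureCI → NewtonTauWeakCI := by
  rintro ⟨C, hC⟩
  exact ⟨C, C, fun k m t f hf hci => (hC k m t f hf hci).trans (pow_kmt_le_two_pow_mul_pow k m t C)⟩

/-- The embedding `ℕ² → ℝ²` of exponent vectors used by `newtonVertexCount`. [folklore] -/
abbrev expoPt (e : Fin 2 →₀ ℕ) : Fin 2 → ℝ := fun i => ((e i : ℕ) : ℝ)

theorem expoPt_injective : Function.Injective expoPt := by
  intro e e' h
  ext i
  have := congrFun h i
  exact_mod_cast this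

/-- **Count form = set form.** `newtonVertexCount F = #supp F` iff every support point of `F` is a
vertex of `Newt(F)` (the vertices of `conv S` always lie in `S`). [folklore] -/
theorem ci_iff (F : MvPolynomial (Fin 2) ℂ) :
    newtonVertexCount F = F.support.card ↔
      expoPt '' (F.support : Set (Fin 2 →₀ ℕ)) ⊆
        Set.extremePoints ℝ (convexHull ℝ (expoPt '' (F.support : Set (Fin 2 →₀ ℕ)))) := by
  classical
  set S : Set (Fin 2 → ℝ) := expoPt '' (F.support : Set (Fin 2 →₀ ℕ)) with hS
  have hfin : S.Finite := (F.support.finite_toSet).image _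
  have hcardS : S.ncard = F.support.card := by
    rw [hS, Set.ncard_image_of_injective _ expoPt_injective, Set.ncard_coe_finset]
  have hsub : Set.extremePoints ℝ (convexHull ℝ S) ⊆ S := extremePoints_convexHull_subset
  change (Set.extremePoints ℝ (convexHull ℝ S)).ncard = F.support.card ↔ S ⊆ Set.extremePoints ℝ (convexHull ℝ S)
  constructor
  · intro h
    have hEq : Set.extremePoints ℝ (convexHull ℝ S) = S :=
      Set.eq_of_subset_of_ncard_le hsub (by rw [h, hcardS]) hfin
    exact hEq.symm.subset
  · intro h
    rw [Set.Subset.antisymm hsub h, hcardS]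

/-- **Sparsity form of the harvested question.** Under convex independence the vertex count IS the
number of monomials, so HY21 Problem 2(b) reads: «a sum of `k` products of `m` `t`-sparse bivariate
polynomials whose support is in convex position has at most `2^{O(m)}(kt)^{O(1)}` MONOMIALS» — a
fewnomial-sparsity statement about cancelling sums of products, not a polygon count. [this file] -/
def SparseSumsCI : Prop :=
  ∃ a b : ℕ, ∀ (k m t : ℕ) (f : Fin k → Fin m → MvPolynomial (Fin 2) ℂ),
    (∀ i j, (f i j).support.card ≤ t) →
      newtonVertexCount (∑ i, ∏ j, f i j) = (∑ i, ∏ j, f i j).support.card →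
        (∑ i, ∏ j, f i j).support.card ≤ 2 ^ (a * m) * (k * t + 2) ^ b

/-- `NewtonTauWeakCI ↔ SparseSumsCI` (rewrite along the convex-independence hypothesis). [folklore] -/
theorem newtonTauWeakCI_iff_sparseSumsCI : NewtonTauWeakCI ↔ SparseSumsCI := by
  constructor
  · rintro ⟨a, b, h⟩
    refine ⟨a, b, fun k m t f hf hci => ?_⟩
    rw [← hci]; exact h k m t f hf hci
  · rintro ⟨a, b, h⟩
    refine ⟨a, b, fun k m t f hf hci => ?_⟩
    rw [hci]; exact h k m t f hf hci

/-! ## §2 The KPTT transfer survives the restriction (kernel) -/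

/-- **`NewtonTauWeakCI → per ∉ VP_ℂ`.** KPTT 2015, proof of Theorem 1 (§3), run verbatim (the
tree's `KPTT.theorem1_holds`): assuming `PER ∈ VP_ℂ`, the witness `F_n = kpttPoly n` is written as
`Σ_{i<k} Π_{j<m} g_ij` with `k, t ≤ (n+2)^{C(⌊√(2n+3)⌋+1)}`, `m ≤ C(⌊√(2n+3)⌋+1)`; the hypothesis is
invoked ONLY at this polynomial, whose support is convexly independent
(`newtonVertexCount_kpttPoly n = 2ⁿ = card_support_kpttPoly n`), so the restricted conjecture
suffices; then `2ⁿ ≤ (n+2)^{O(√n)}` is absurd (`exists_pow_sqrt_lt_two_pow`).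
[cite: KoiranPortierTavenasThomasse2015, Thm. 1, §3] [cite: HrubesYehudayoff2021, §9 Problem 2] -/
theorem not_isVPFamily_per_of_newtonTauWeakCI :
    NewtonTauWeakCI → ¬ IsVPFamily (fun n => perPoly (Fin n) ℂ) := by
  intro hW hVP
  obtain ⟨a, b, hab⟩ := hW
  -- Step 2: `h_n` is a projection of `PER_{q(n)}` over `ℂ`
  obtain ⟨q, hq, hproj⟩ := exists_isProjection_hV_perPoly_complex
  -- Step 3: the sum-of-products-of-sparse form of `F_n`
  have hdP : IsPBounded (fun n => 2 * n + 3) :=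
    (IsPBounded.iff_exists_le_mul_succ_pow _).2 ⟨3, 1, fun n => by rw [pow_one]; omega⟩
  obtain ⟨C, hC⟩ := exists_sps_xy_of_isProjection_perPoly hVP.2 (fun n => 2 * n + 3) (fun n => 2 * n + 3) hdP
    (fun n => le_rfl) q hq (fun n => hV ℂ n) hproj (fun n => hV_multilinear n)
  -- Step 4: the bad `n`
  obtain ⟨n, hn⟩ := exists_pow_sqrt_lt_two_pow ((a + 2 * b) * C + 2 * b)
  obtain ⟨k, m, t, g, hk, hm, ht, hg, hsum⟩ := hC n
  -- the ONLY use of the hypothesis: at `F_n`, whose support is convexly independent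
  have hF : (∑ i, ∏ j, g i j) = kpttPoly n := by
    rw [hsum]; exact aeval_xySubst_hV n
  have hCI : newtonVertexCount (∑ i, ∏ j, g i j) = (∑ i, ∏ j, g i j).support.card := by
    rw [hF, newtonVertexCount_kpttPoly, card_support_kpttPoly]
  have hcount := hab k m t g hg hCI
  rw [hF, newtonVertexCount_kpttPoly] at hcount
  -- `2^(a m) (k t + 2)^b ≤ (n + 2)^{K (s + 4)}` with `s = ⌊√(2n+3)⌋`, `E = C (s + 1)`
  set s : ℕ := Nat.sqrt (2 * n + 3) with hs
  set E : ℕ := C * (s + 1) with hE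
  have hB2 : 2 ≤ n + 2 := by omega
  have h2am : 2 ^ (a * m) ≤ (n + 2) ^ (a * E) :=
    calc 2 ^ (a * m) ≤ (n + 2) ^ (a * m) := Nat.pow_le_pow_left hB2 _
      _ ≤ (n + 2) ^ (a * E) := Nat.pow_le_pow_right (by omega) (Nat.mul_le_mul_left a hm)
  have hkt : k * t + 2 ≤ (n + 2) ^ (2 * E + 2) := by
    have h4 : 4 ≤ (n + 2) ^ 2 := by
      calc 4 = 2 ^ 2 := by norm_num
        _ ≤ (n + 2) ^ 2 := Nat.pow_le_pow_left hB2 2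
    have hkt' : k * t ≤ (n + 2) ^ (2 * E) :=
      calc k * t ≤ (n + 2) ^ E * (n + 2) ^ E := Nat.mul_le_mul hk ht
        _ = (n + 2) ^ (2 * E) := by rw [← pow_add, two_mul]
    have h1' : 1 ≤ (n + 2) ^ (2 * E) := Nat.one_le_pow _ _ (by omega)
    calc k * t + 2 ≤ (n + 2) ^ (2 * E) * 4 := by omega
      _ ≤ (n + 2) ^ (2 * E) * (n + 2) ^ 2 := Nat.mul_le_mul_left _ h4
      _ = (n + 2) ^ (2 * E + 2) := by rw [← pow_add]
  have hbound : 2 ^ (a * m) * (k * t + 2) ^ b ≤ (n + 2) ^ (a * E + (2 * E + 2) * b) :=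
    calc 2 ^ (a * m) * (k * t + 2) ^ b ≤ (n + 2) ^ (a * E) * ((n + 2) ^ (2 * E + 2)) ^ b :=
          Nat.mul_le_mul h2am (Nat.pow_le_pow_left hkt b)
      _ = (n + 2) ^ (a * E + (2 * E + 2) * b) := by rw [← pow_mul, ← pow_add]
  have hexp : a * E + (2 * E + 2) * b ≤ ((a + 2 * b) * C + 2 * b) * (s + 4) := by
    rw [hE]; nlinarith
  have key : 2 ^ n ≤ (n + 2) ^ (((a + 2 * b) * C + 2 * b) * (s + 4)) :=
    calc 2 ^ n ≤ 2 ^ (a * m) * (k * t + 2) ^ b := hcount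
      _ ≤ (n + 2) ^ (a * E + (2 * E + 2) * b) := hbound
      _ ≤ (n + 2) ^ (((a + 2 * b) * C + 2 * b) * (s + 4)) := Nat.pow_le_pow_right (by omega) hexp
  exact absurd key (not_le.2 hn)

/-- **`NewtonTauWeakCI → VP_ℂ ≠ VNP_ℂ`** through the permanent hub (`per ∈ VNP`, Valiant 1979, and
the renaming bridge, both landed). Bookkeeping. [folklore] -/
theorem valiantsHypothesis_of_newtonTauWeakCI : NewtonTauWeakCI → ValiantsHypothesis := fun h =>
  Summit.ValiantsHypothesis.Hub.valiantsHypothesis_of_not_isVPFamily_per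
    (not_isVPFamily_per_of_newtonTauWeakCI h) (mem_VP_ofFintype_iff_holds _) (perFamily_mem_VNP_holds ℂ)

/-- The same in Hrubeš–Yehudayoff's polynomial currency: a positive answer to §9 Problem 2(b) AS
PRINTED already gives `VP_ℂ ≠ VNP_ℂ`. [cite: HrubesYehudayoff2021, §9 Problem 2] -/
theorem valiantsHypothesis_of_newtonTauConjectureCI : NewtonTauConjectureCI → ValiantsHypothesis :=
  fun h => valiantsHypothesis_of_newtonTauWeakCI (newtonTauWeakCI_of_newtonTauConjectureCI h)

/-! ## §3 The `k = 2` rung in the currency of the crux -/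

/-- **`TwoProductsCI`**: the crux `TwoProducts` (stmt-5906) restricted to convexly independent
OUTPUT support — for t-sparse `f_j, g_j`, if every monomial of `h = Π f_j − Π g_j` is a vertex of
`Newt(h)` then `#vert Newt(h) ≤ 2^{a m}(t+2)^b`. OPEN; the `k = 2` case of HY21 Problem 2(b).
[cite: HrubesYehudayoff2021, §9 Problem 2] [cite: KoiranPortierTavenasThomasse2015, §5] -/
def TwoProductsCI : Prop :=
  ∃ a b : ℕ, ∀ (m t : ℕ) (f g : Fin m → MvPolynomial (Fin 2) ℂ),
    (∀ j, (f j).support.card ≤ t) → (∀ j, (g j).support.card ≤ t) →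
      newtonVertexCount (∏ j, f j - ∏ j, g j) = (∏ j, f j - ∏ j, g j).support.card →
        newtonVertexCount (∏ j, f j - ∏ j, g j) ≤ 2 ^ (a * m) * (t + 2) ^ b

/-- Restriction: the crux implies its convexly-independent-output case. [folklore] -/
theorem twoProductsCI_of_twoProducts : Theses.NewtonUnitEquations.TwoProducts → TwoProductsCI := by
  rintro ⟨a, b, hab⟩
  exact ⟨a, b, fun m t f g hf hg _ => hab m t f g hf hg⟩

/-- The Newton polygon of `0` has no vertices. [folklore] -/
theorem newtonVertexCount_zero : newtonVertexCount (0 : MvPolynomial (Fin 2) ℂ) = 0 := by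
  simp [newtonVertexCount]

/-- **`NewtonTauWeakCI → TwoProductsCI`** (`k = 2`, the second product with one factor negated;
`2^{am}(2t+2)^b ≤ 2^{(a+b)m}(t+2)^b` for `m ≥ 1`, and `h = 0` for `m = 0`). [folklore] -/
theorem twoProductsCI_of_newtonTauWeakCI : NewtonTauWeakCI → TwoProductsCI := by
  rintro ⟨a, b, hab⟩
  refine ⟨a + b, b, fun m t f g hf hg hCI => ?_⟩
  cases m with
  | zero =>
    have h0 : (∏ j : Fin 0, f j - ∏ j : Fin 0, g j) = 0 := by simp
    rw [h0, newtonVertexCount_zero]; exact Nat.zero_le _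
  | succ m =>
    -- the 2 × (m+1) array: row 0 = f, row 1 = g with its first factor negated
    set g' : Fin (m + 1) → MvPolynomial (Fin 2) ℂ := Fin.cons (-g 0) (Fin.tail g) with hg'
    have hprodg' : ∏ j, g' j = -∏ j, g j := by
      rw [Fin.prod_univ_succ, Fin.prod_univ_succ g]
      simp only [hg', Fin.cons_zero, Fin.cons_succ, Fin.tail]
      ring
    set F : Fin 2 → Fin (m + 1) → MvPolynomial (Fin 2) ℂ := Fin.cons f (Fin.cons g' finZeroElim) with hFdef
    have hF0 : F 0 = f := by simp [hFdef]
    have hF1 : F 1 = g' := by simp [hFdef]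
    have hsum : (∑ i, ∏ j, F i j) = ∏ j, f j - ∏ j, g j := by
      rw [Fin.sum_univ_two, hF0, hF1, hprodg', sub_eq_add_neg]
    have hsparse : ∀ i j, (F i j).support.card ≤ t := by
      intro i j
      fin_cases i
      · simpa [hFdef] using hf j
      · show (g' j).support.card ≤ t
        refine Fin.cases ?_ (fun j' => ?_) j
        · simpa [hg', MvPolynomial.support_neg] using hg 0
        · simpa [hg', Fin.tail] using hg j'.succ
    have hcount := hab 2 (m + 1) t F hsparse (by rw [hsum]; exact hCI)
    rw [hsum] at hcount
    refine hcount.trans ?_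
    -- 2^(a(m+1)) (2t+2)^b ≤ 2^((a+b)(m+1)) (t+2)^b
    have h1 : (2 * t + 2) ^ b ≤ 2 ^ (b * (m + 1)) * (t + 2) ^ b :=
      calc (2 * t + 2) ^ b ≤ (2 * (t + 2)) ^ b := Nat.pow_le_pow_left (by omega) b
        _ = 2 ^ b * (t + 2) ^ b := by rw [mul_pow]
        _ ≤ 2 ^ (b * (m + 1)) * (t + 2) ^ b :=
            Nat.mul_le_mul_right _ (Nat.pow_le_pow_right (by omega) (by nlinarith))
    calc 2 ^ (a * (m + 1)) * (2 * t + 2) ^ b ≤ 2 ^ (a * (m + 1)) * (2 ^ (b * (m + 1)) * (t + 2) ^ b) :=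
          Nat.mul_le_mul_left _ h1
      _ = 2 ^ ((a + b) * (m + 1)) * (t + 2) ^ b := by rw [← mul_assoc, ← pow_add]; ring_nf

/-! ## §4 Calibration: convexly independent outputs with many hidden vertices (m = 2) -/

/-- The `m = 2` calibration family of the memo: `f₁ = P + q`, `f₂ = P − q`, `g₁ = P + s + q`,
`g₂ = P + s − q` give `f₁f₂ − g₁g₂ = −(2sP + s²)` — the output is (a shift of) `P` itself plus one
point, so a convexly independent `supp P ∪ {2s}`-configuration yields a convexly independent OUTPUT
all but one of whose vertices are hidden inside `conv(supp(f₁f₂) ∪ supp(g₁g₂))`. [folklore] -/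
theorem calibration_identity {R : Type*} [CommRing R] (P q s : R) :
    (P + q) * (P - q) - (P + s + q) * (P + s - q) = -(2 * s * P + s * s) := by
  ring

end Summit.ValiantsHypothesis.ValiantsHypothesis.Cruxes.TwoProducts.HarvestCI
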